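/-
Origin: expansion seat `planner-pub-hodgecm-pv07-g2-0`, handover #9 2026-08-18T07:01:48Z (`HOME/pub-hodgecm-pv07-g2/lean/Pv07g2/SplitUnitaryLine.lean`, md5 e70fa0db, 230 lines);
landed by the gen-7 packager in gate run 25 as `HodgeCM/PerL34/LocalFactors/SplitUnitaryLine.lean` (verbatim).
-/
/-
Origin: pub-hodgecm-pv07-g2 (DAG-NODE PROVER #07, gen 2), 2026-08-18.
Slot:   HodgeCM/PerL34/LocalFactors/SplitUnitaryLine.lean   (module rename `Pv07g2.SplitUnitaryLine` →
        `HodgeCM.PerL34.LocalFactors.SplitUnitaryLine`; imports Mathlib + the tree's `HodgeCM.Vendored.Hermitian`).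
-/
import Mathlib.Algebra.Ring.Prod
import Mathlib.Algebra.Group.Subgroup.Basic
import Mathlib.Algebra.Group.Units.Hom
import Mathlib.Algebra.Group.Units.Equiv
import Mathlib.Algebra.Field.Basic
import Summits.HodgeConjecture.HodgeCM.Vendored.Hermitian

/-!
# D4 (a), kernel version: at a split place the unitary group of a Hermitian line is `L_{0,v}ˣ`

PerL v5, proof of Lemma 4.2(b), tex l. 617: *"at a split place `v`, `U(W_i)(L_{0,v}) ≅ L_{0,v}^×"*.
This is the GROUP half of the residual D4 of the `pv07` lineage (`GAPS.md` pv07-G1, pv07g2-K4 (i)); the other half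
(the restricted Weil representation acts through the dilation model) stays print ([MVW] LNM 1291 ch. 3 §III.1).

The algebra: `v` splits in the CM extension `L/L₀`, so `L ⊗_{L₀} L_{0,v} = F × F` (`F := L_{0,v}`) with complex
conjugation acting as the FLIP `(a, b) ↦ (b, a)`; for a (skew-)Hermitian LINE `W_i` the unitary group is the norm-one
group `{g ∈ (F × F)ˣ : g · ḡ = 1}` (independent of the Hermitian form on the line), and `g = (a, b)` has `g ḡ = (ab, ab)`,
so `g ḡ = 1 ↔ b = a⁻¹`, i.e. `U(W_i)(F) ≅ Fˣ` by the first projection.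

## Contents (namespace `HodgeCM.PerL34.LocalFactors.SplitUnitaryLine`; `F` any commutative ring)

* `conj F : (F × F) ≃+* (F × F)` — the flip (`RingEquiv.prodComm`), an involution (`conj_conj`);
* `normMap F : (F × F)ˣ →* (F × F)ˣ`, `g ↦ g · conj g`; `unitaryGroup F : Subgroup (F × F)ˣ := (normMap F).ker`;
  `mem_unitaryGroup_iff : g ∈ unitaryGroup F ↔ (g : F × F) * conj F g = 1`,
  `mem_unitaryGroup_iff_fst_mul_snd : g ∈ unitaryGroup F ↔ (g : F × F).1 * (g : F × F).2 = 1`;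
* `toUnits F : unitaryGroup F →* Fˣ` (first projection; `coe_toUnits_inv`: the second coordinate is the inverse of
  the first), `pairUnit`, `ofUnits F : Fˣ →* unitaryGroup F` (`a ↦ (a, a⁻¹)`),
  **`unitaryGroupEquiv F : unitaryGroup F ≃* Fˣ`** (tex l. 617, D4 (a)), `coe_eq_pair : g = (a, a⁻¹)`;
* the same for the PACKAGE's unitary group `Literature.AlgebraicGeometry.ShimuraVarieties.unitaryGroup σ H ≤ GL_m`
  (`HodgeCM.Vendored.Hermitian`, the `U(H)` of `HodgeCM.CM.Basic`) of a NON-DEGENERATE Hermitian LINE over the split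
  algebra (`m` a one-point type, `H = (δ)` with `δ ∈ (F × F)ˣ`, involution `σ = conj F`): `matrixUniqueEquiv :
  Matrix m m R ≃+* R`, `glUniqueEquiv : GL m R ≃* Rˣ`, `mem_unitaryGroup_line_iff : g ∈ U(H) ↔ σ(g₁₁) g₁₁ = 1`,
  `map_glUniqueEquiv_unitaryGroup : U(H).map glUniqueEquiv = unitaryGroup F`,
  **`packageLineEquiv F H hH : ShimuraVarieties.unitaryGroup (conj F) H ≃* Fˣ`**, `entry_eq_pair : g₁₁ = (a, a⁻¹)`.

Pure algebra over Mathlib; nothing cited or posited.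
-/

namespace HodgeCM.PerL34.LocalFactors.SplitUnitaryLine

variable (F : Type*) [CommRing F]

/-- complex conjugation of `L ⊗ L_{0,v} = F × F` at a split place: the flip. -/
def conj : (F × F) ≃+* (F × F) := RingEquiv.prodComm

/-- (Ported verbatim from the HodgeCMPerL package; no docstring in the source.) -/
@[simp] theorem conj_apply (x : F × F) : conj F x = (x.2, x.1) := rfl

/-- (Ported verbatim from the HodgeCMPerL package; no docstring in the source.) -/
@[simp] theorem conj_conj (x : F × F) : conj F (conj F x) = x := rfl

/-- the norm map `g ↦ g · ḡ` on units of the split algebra (a homomorphism since `F × F` is commutative). -/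
def normMap : (F × F)ˣ →* (F × F)ˣ where
  toFun g := g * Units.map (conj F : (F × F) →* (F × F)) g
  map_one' := by rw [map_one, mul_one]
  map_mul' g h := by rw [map_mul]; exact mul_mul_mul_comm _ _ _ _

/-- (Ported verbatim from the HodgeCMPerL package; no docstring in the source.) -/
@[simp] theorem coe_normMap (g : (F × F)ˣ) : (normMap F g : F × F) = (g : F × F) * conj F g := rfl

/-- `U(W_i)(L_{0,v})` at a split place: the norm-one units of `F × F`. -/
def unitaryGroup : Subgroup (F × F)ˣ := (normMap F).ker

variable {F}

/-- (Ported verbatim from the HodgeCMPerL package; no docstring in the source.) -/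
theorem mem_unitaryGroup_iff (g : (F × F)ˣ) : g ∈ unitaryGroup F ↔ (g : F × F) * conj F g = 1 := by
  rw [unitaryGroup, MonoidHom.mem_ker, ← Units.val_eq_one, coe_normMap]

/-- (Ported verbatim from the HodgeCMPerL package; no docstring in the source.) -/
theorem mem_unitaryGroup_iff_fst_mul_snd (g : (F × F)ˣ) :
    g ∈ unitaryGroup F ↔ (g : F × F).1 * (g : F × F).2 = 1 := by
  rw [mem_unitaryGroup_iff, Prod.ext_iff]
  change (g : F × F).1 * (g : F × F).2 = 1 ∧ (g : F × F).2 * (g : F × F).1 = 1 ↔ _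
  rw [mul_comm (g : F × F).2, and_self]

/-- (Ported verbatim from the HodgeCMPerL package; no docstring in the source.) -/
theorem fst_mul_snd_of_mem {g : (F × F)ˣ} (hg : g ∈ unitaryGroup F) : (g : F × F).1 * (g : F × F).2 = 1 :=
  (mem_unitaryGroup_iff_fst_mul_snd g).1 hg

variable (F)

/-- first projection `U(W_i)(F) → Fˣ`, `(a, b) ↦ a` -/
def toUnits : unitaryGroup F →* Fˣ :=
  (Units.map (RingHom.fst F F : (F × F) →* F)).comp (unitaryGroup F).subtype

/-- (Ported verbatim from the HodgeCMPerL package; no docstring in the source.) -/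
@[simp] theorem coe_toUnits (g : unitaryGroup F) : (toUnits F g : F) = ((g : (F × F)ˣ) : F × F).1 := rfl

/-- the second coordinate of `g ∈ U(W_i)(F)` is the inverse of the first -/
theorem coe_toUnits_inv (g : unitaryGroup F) : ((toUnits F g)⁻¹ : Fˣ) = (((g : (F × F)ˣ) : F × F).2 : F) :=
  Units.inv_eq_of_mul_eq_one_right (fst_mul_snd_of_mem g.2)

/-- the unit `(a, a⁻¹)` of `F × F` -/
def pairUnit (a : Fˣ) : (F × F)ˣ :=
  ⟨((a : F), ((a⁻¹ : Fˣ) : F)), (((a⁻¹ : Fˣ) : F), (a : F)), Prod.ext a.mul_inv a.inv_mul,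
    Prod.ext a.inv_mul a.mul_inv⟩

/-- (Ported verbatim from the HodgeCMPerL package; no docstring in the source.) -/
@[simp] theorem coe_pairUnit (a : Fˣ) : (pairUnit F a : F × F) = ((a : F), ((a⁻¹ : Fˣ) : F)) := rfl

/-- (Ported verbatim from the HodgeCMPerL package; no docstring in the source.) -/
theorem pairUnit_mem (a : Fˣ) : pairUnit F a ∈ unitaryGroup F :=
  (mem_unitaryGroup_iff_fst_mul_snd _).2 a.mul_inv

/-- the inverse map `Fˣ → U(W_i)(F)`, `a ↦ (a, a⁻¹)` -/
def ofUnits : Fˣ →* unitaryGroup F where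
  toFun a := ⟨pairUnit F a, pairUnit_mem F a⟩
  map_one' := Subtype.ext <| Units.ext <| Prod.ext rfl (by simp)
  map_mul' a b := Subtype.ext <| Units.ext <| Prod.ext rfl (by simp [mul_comm])

/-- (Ported verbatim from the HodgeCMPerL package; no docstring in the source.) -/
@[simp] theorem coe_ofUnits (a : Fˣ) :
    (((ofUnits F a : unitaryGroup F) : (F × F)ˣ) : F × F) = ((a : F), ((a⁻¹ : Fˣ) : F)) := rfl

/-- (Ported verbatim from the HodgeCMPerL package; no docstring in the source.) -/
@[simp] theorem toUnits_ofUnits (a : Fˣ) : toUnits F (ofUnits F a) = a := Units.ext rfl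

/-- (Ported verbatim from the HodgeCMPerL package; no docstring in the source.) -/
@[simp] theorem ofUnits_toUnits (g : unitaryGroup F) : ofUnits F (toUnits F g) = g :=
  Subtype.ext <| Units.ext <| Prod.ext rfl (coe_toUnits_inv F g)

/-- **D4 (a)** (PerL v5 l. 617): at a split place the unitary group of a Hermitian line over the split quadratic
algebra is the multiplicative group of the base field, `U(W_i)(L_{0,v}) ≃* L_{0,v}ˣ`, via the first projection. -/
def unitaryGroupEquiv : unitaryGroup F ≃* Fˣ :=
  { toUnits F with
    invFun := ofUnits F
    left_inv := ofUnits_toUnits F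
    right_inv := toUnits_ofUnits F }

/-- (Ported verbatim from the HodgeCMPerL package; no docstring in the source.) -/
@[simp] theorem unitaryGroupEquiv_apply (g : unitaryGroup F) : unitaryGroupEquiv F g = toUnits F g := rfl

/-- (Ported verbatim from the HodgeCMPerL package; no docstring in the source.) -/
@[simp] theorem unitaryGroupEquiv_symm_apply (a : Fˣ) : (unitaryGroupEquiv F).symm a = ofUnits F a := rfl

/-- in coordinates: `g = (a, a⁻¹)` for every `g ∈ U(W_i)(F)`, `a := unitaryGroupEquiv F g` -/
theorem coe_eq_pair (g : unitaryGroup F) :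
    ((g : (F × F)ˣ) : F × F) = ((unitaryGroupEquiv F g : F), (((unitaryGroupEquiv F g)⁻¹ : Fˣ) : F)) :=
  Prod.ext rfl (coe_toUnits_inv F g).symm

/-! ### The same for the package's `unitaryGroup σ H` (vendored `Hermitian`): a non-degenerate Hermitian line -/

section PackageUnitaryGroup

open Matrix Literature.AlgebraicGeometry

variable {R : Type*} [CommRing R] {m : Type*} [Fintype m] [Unique m]

/-- `1 × 1` matrices: `Matrix m m R ≃+* R` for a one-point index type. -/
def matrixUniqueEquiv : Matrix m m R ≃+* R where
  toFun M := M default default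
  invFun a := Matrix.of fun _ _ => a
  left_inv M := by
    ext i j
    obtain rfl : i = default := Unique.eq_default i
    obtain rfl : j = default := Unique.eq_default j
    rfl
  right_inv a := rfl
  map_mul' M N := by simp only [Matrix.mul_apply, Fintype.sum_unique]
  map_add' M N := rfl

/-- (Ported verbatim from the HodgeCMPerL package; no docstring in the source.) -/
@[simp] theorem matrixUniqueEquiv_apply (M : Matrix m m R) : matrixUniqueEquiv M = M default default := rfl

variable [DecidableEq m]

/-- `GL₁(R) ≃* Rˣ`. -/
def glUniqueEquiv : GL m R ≃* Rˣ := Units.mapEquiv (matrixUniqueEquiv (R := R) (m := m)).toMulEquiv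

/-- (Ported verbatim from the HodgeCMPerL package; no docstring in the source.) -/
@[simp] theorem coe_glUniqueEquiv (g : GL m R) : (glUniqueEquiv g : R) = (g : Matrix m m R) default default := rfl

/-- (Ported verbatim from the HodgeCMPerL package; no docstring in the source.) -/
@[simp] theorem coe_glUniqueEquiv_symm (u : Rˣ) :
    ((glUniqueEquiv (m := m)).symm u : Matrix m m R) default default = (u : R) := rfl

/-- membership in the package's unitary group of a NON-DEGENERATE Hermitian line `H = (δ)`, `δ` a unit:
`g ∈ U(H) ↔ σ(g) g = 1` (the form cancels). -/
theorem mem_unitaryGroup_line_iff (σ : R →+* R) (H : Matrix m m R) (hH : IsUnit (H default default))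
    (g : GL m R) :
    g ∈ ShimuraVarieties.unitaryGroup σ H ↔ σ ((g : Matrix m m R) default default) * (g : Matrix m m R) default default = 1 := by
  rw [ShimuraVarieties.mem_unitaryGroup_iff]
  constructor
  · intro h
    have h1 := congr_fun (congr_fun h default) default
    simp only [Matrix.mul_apply, Fintype.sum_unique, transpose_apply, Matrix.map_apply] at h1
    refine hH.mul_right_cancel ?_
    rw [one_mul]
    calc σ ((g : Matrix m m R) default default) * (g : Matrix m m R) default default * H default default
        = σ ((g : Matrix m m R) default default) * H default default * (g : Matrix m m R) default default := by ring
      _ = H default default := h1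
  · intro h
    ext i j
    obtain rfl : i = default := Unique.eq_default i
    obtain rfl : j = default := Unique.eq_default j
    simp only [Matrix.mul_apply, Fintype.sum_unique, transpose_apply, Matrix.map_apply]
    calc σ ((g : Matrix m m R) default default) * H default default * (g : Matrix m m R) default default
        = σ ((g : Matrix m m R) default default) * (g : Matrix m m R) default default * H default default := by ring
      _ = H default default := by rw [h, one_mul]

variable (F : Type*) [CommRing F]

/-- under `GL₁(F × F) ≃* (F × F)ˣ` the package's `U(H)` of a non-degenerate Hermitian line over the split algebra
(involution = flip) is the norm-one group `unitaryGroup F`. -/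
theorem map_glUniqueEquiv_unitaryGroup (H : Matrix m m (F × F)) (hH : IsUnit (H default default)) :
    (ShimuraVarieties.unitaryGroup (conj F).toRingHom H).map (glUniqueEquiv (R := F × F) (m := m)).toMonoidHom
      = unitaryGroup F := by
  ext g
  rw [Subgroup.mem_map, mem_unitaryGroup_iff]
  constructor
  · rintro ⟨g', hg', rfl⟩
    rw [mem_unitaryGroup_line_iff _ _ hH] at hg'
    rw [mul_comm]; exact hg'
  · intro hg
    refine ⟨(glUniqueEquiv (m := m)).symm g, ?_, MulEquiv.apply_symm_apply _ _⟩
    rw [mem_unitaryGroup_line_iff _ _ hH, coe_glUniqueEquiv_symm, mul_comm]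
    exact hg

/-- **D4 (a) for the package's unitary group** (PerL v5 l. 617): for a non-degenerate Hermitian LINE `H = (δ)` over
the split algebra `F × F` with the flip involution, `U(H) ≃* Fˣ` — first map `GL₁ → units`, then `unitaryGroupEquiv`. -/
def packageLineEquiv (H : Matrix m m (F × F)) (hH : IsUnit (H default default)) :
    ShimuraVarieties.unitaryGroup (conj F).toRingHom H ≃* Fˣ :=
  ((MulEquiv.subgroupMap (glUniqueEquiv (R := F × F) (m := m)) _).trans
    (MulEquiv.subgroupCongr (map_glUniqueEquiv_unitaryGroup F H hH))).trans (unitaryGroupEquiv F)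

/-- (Ported verbatim from the HodgeCMPerL package; no docstring in the source.) -/
theorem coe_packageLineEquiv (H : Matrix m m (F × F)) (hH : IsUnit (H default default))
    (g : ShimuraVarieties.unitaryGroup (conj F).toRingHom H) :
    (packageLineEquiv F H hH g : F) = (((g : GL m (F × F)) : Matrix m m (F × F)) default default).1 := rfl

/-- in coordinates: the single entry of `g ∈ U(H)` is `(a, a⁻¹)`, `a := packageLineEquiv F H hH g`. -/
theorem entry_eq_pair (H : Matrix m m (F × F)) (hH : IsUnit (H default default))
    (g : ShimuraVarieties.unitaryGroup (conj F).toRingHom H) :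
    ((g : GL m (F × F)) : Matrix m m (F × F)) default default
      = ((packageLineEquiv F H hH g : F), (((packageLineEquiv F H hH g)⁻¹ : Fˣ) : F)) := by
  have := coe_eq_pair F ((MulEquiv.subgroupMap (glUniqueEquiv (R := F × F) (m := m)) _).trans
    (MulEquiv.subgroupCongr (map_glUniqueEquiv_unitaryGroup F H hH)) g)
  exact this

end PackageUnitaryGroup

end HodgeCM.PerL34.LocalFactors.SplitUnitaryLine
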